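import Summits.AtomisticToContinuum.HydrodynamicLimit.Theses.ImplosionDichotomy
import Summits.AtomisticToContinuum.HydrodynamicLimit.Theorems.DenseExcursion.Negative.Untied
import Summits.AtomisticToContinuum.HydrodynamicLimit.Theorems.DenseExcursion.Negative.Degenerate
import Summits.AtomisticToContinuum.HydrodynamicLimit.Theorems.DenseExcursion.Negative.Dichotomy
import Summits.AtomisticToContinuum.HydrodynamicLimit.Theorems.PolynomialCompression.Negative.PdeForm
import Summits.AtomisticToContinuum.HydrodynamicLimit.Theorems.PolynomialCompression.Negative.Ladder
import Summits.AtomisticToContinuum.HydrodynamicLimit.Theorems.ImplosionDichotomyPolynomialCompression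

/-!
# The quantifier skeleton of `DiluteSelfConsistency` is load-bearing (negative lemmas, crux stmt-3091)

Negative knowledge for the crux `ImplosionDichotomy.DiluteSelfConsistency` (stmt-AtomisticToContinuum-3091):
"for every `η > 0` and all continuous positive profiles there is `σ₀ > 0` such that for `0 < σ < σ₀` every
ADMISSIBLE classical hard-sphere-Euler solution (tied at `t = 0` to the local Gibbs laws) keeps packing
`ρ_t(x)σ³ < η` on `[0,T)`". From the standing disprover's work file
`Cruxes/DiluteSelfConsistency/Disproof.lean` (refuter-cdisprove-stmt-AtomisticToContinuum-3091-0), landed so that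
ideators / planners / consumers of stmt-3091 can import them. Every statement below is the crux with ONE hypothesis
dropped or ONE quantifier moved, and each is decided:

* `exists_admissible_restState` — THE HYPOTHESIS CLASS IS INHABITED AT EVERY SMALL `σ`: for the homogeneous profiles
  `(a₀, u₀, θ₀) = (1, 0, 1)` and every `σ` below an absolute threshold, the rest state of density
  `r_σ = rhoLim (profileOf 1) σ > 0` (the LLN density of the canonical hard-sphere gas, a constant by homogeneity) is a
  GLOBAL classical solution, tied at `t = 0` through a flow family (Alexander) — so the crux is not vacuously true,
  and its conclusion is tested on a non-empty class at every small `σ` (`not_diluteSelfConsistencyVacuous`);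
* `diluteSelfConsistency_false_without_level_pos` — `0 < η` IS LOAD-BEARING: at level `η = 0` the rest state has
  packing `r_σ σ³ > 0`;
* `not_diluteSelfConsistencyLevelUniform` — `σ₀` MUST DEPEND ON `η`: "`∃ σ₀ ∀ η > 0`" says packing `≤ 0`, refuted by
  the same rest state (so DSC is exactly `limsup_{σ→0} sup packing = 0`, never "packing eventually zero");
* `diluteSelfConsistency_false_without_activity_pos` / `…_without_temperature_pos` / `…_untied` — the positivity
  clauses and the `t = 0` tie are load-bearing (re-typed from the landed `DenseExcursion` §6 lemmas
  `denseExcursionNonnegActivity_holds`, `denseExcursionNonnegTemperature_holds`, `denseExcursionUntied_holds`: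
  at `a₀ ≡ 0` or `θ₀ ≡ 0` the laws vanish and the tie is vacuous; untied, the dense rest state `σ⁻³` is classical);
* `not_diluteSelfConsistencyPolynomialRate` / `not_diluteSelfConsistencyBoundedDensity` — NO QUANTITATIVE UPGRADE:
  the packing bound `< η` cannot be improved to `< σ^(3-κ)` for any `κ > 0` profile by profile, nor to a σ-uniform
  density bound `ρ ≤ M(profiles)`, because `PolynomialCompression` is PROVED (`polynomialCompression_proof`:
  density `σ^(-κ)` IS reached along admissible solutions from fixed smooth profiles).

What is NOT decided here (and why): dropping `Continuous a₀/θ₀/u₀` only ADDS profiles for which no classical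
solution can be tied (the pinned data would be discontinuous), so continuity is not load-bearing for falsity;
`σ < σ₀` uniform in the PROFILES is refuted separately (`Negative/ProfileUniform.lean`, tall activity peaks are
dense at `t = 0`); the crux itself is `¬ DenseExcursion` (`not_denseExcursion_iff_diluteSelfConsistency`) and resists
— see the work file's census.
-/

noncomputable section

namespace Summit.AtomisticToContinuum.HydrodynamicLimit.Theorems

open MeasureTheory Filter Set Topology
open Literature.MathematicalPhysics.KineticTheory Literature.Analysis.FluidPDE
open Summit.AtomisticToContinuum.HydrodynamicLimit.Theses.ImplosionDichotomy

/-! ## The mutated statements (each is `DiluteSelfConsistency` with ONE change, all else verbatim) -/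

/-- `DiluteSelfConsistency` with the level hypothesis `0 < η` DROPPED. -/
def DiluteSelfConsistencyAnyLevel : Prop :=
  ∀ η : ℝ, ∀ (a₀ θ₀ : T3 → ℝ) (u₀ : T3 → V3), Continuous a₀ → Continuous θ₀ → Continuous u₀ →
    (∀ x, 0 < a₀ x) → (∀ x, 0 < θ₀ x) → ∃ σ₀ : ℝ, 0 < σ₀ ∧ ∀ σ : ℝ, 0 < σ → σ < σ₀ →
      ∀ (T : ℝ) (ρ θ : ℝ → T3 → ℝ) (u : ℝ → T3 → V3), IsHardSphereEulerSolution σ T ρ u θ →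
        ∀ Φ : (N : ℕ) → HardSphereFlow (Torus.geometry (Fin 3)) (hsDiameter σ N) (N + 1),
          TendstoHydroFieldsAt (fun N => localGibbsLaw σ a₀ u₀ θ₀ N (Φ N)) Φ ρ u θ 0 →
            ∀ t ∈ Ico 0 T, ∀ x, ρ t x * σ ^ 3 < η

/-- `DiluteSelfConsistency` with the threshold chosen BEFORE the level: `∃ σ₀ ∀ η > 0` (uniform in `η`). -/
def DiluteSelfConsistencyLevelUniform : Prop :=
  ∀ (a₀ θ₀ : T3 → ℝ) (u₀ : T3 → V3), Continuous a₀ → Continuous θ₀ → Continuous u₀ →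
    (∀ x, 0 < a₀ x) → (∀ x, 0 < θ₀ x) → ∃ σ₀ : ℝ, 0 < σ₀ ∧ ∀ η : ℝ, 0 < η → ∀ σ : ℝ, 0 < σ → σ < σ₀ →
      ∀ (T : ℝ) (ρ θ : ℝ → T3 → ℝ) (u : ℝ → T3 → V3), IsHardSphereEulerSolution σ T ρ u θ →
        ∀ Φ : (N : ℕ) → HardSphereFlow (Torus.geometry (Fin 3)) (hsDiameter σ N) (N + 1),
          TendstoHydroFieldsAt (fun N => localGibbsLaw σ a₀ u₀ θ₀ N (Φ N)) Φ ρ u θ 0 →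
            ∀ t ∈ Ico 0 T, ∀ x, ρ t x * σ ^ 3 < η

/-- VACUITY FORM: "below a profile-dependent threshold no admissible classical solution has a positive existence
time" (the conclusion of `DiluteSelfConsistency` replaced by `False`). -/
def DiluteSelfConsistencyVacuous : Prop :=
  ∀ (a₀ θ₀ : T3 → ℝ) (u₀ : T3 → V3), Continuous a₀ → Continuous θ₀ → Continuous u₀ →
    (∀ x, 0 < a₀ x) → (∀ x, 0 < θ₀ x) → ∃ σ₀ : ℝ, 0 < σ₀ ∧ ∀ σ : ℝ, 0 < σ → σ < σ₀ →
      ∀ (T : ℝ) (ρ θ : ℝ → T3 → ℝ) (u : ℝ → T3 → V3), IsHardSphereEulerSolution σ T ρ u θ →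
        ∀ Φ : (N : ℕ) → HardSphereFlow (Torus.geometry (Fin 3)) (hsDiameter σ N) (N + 1),
          TendstoHydroFieldsAt (fun N => localGibbsLaw σ a₀ u₀ θ₀ N (Φ N)) Φ ρ u θ 0 →
            ∀ t ∈ Ico 0 T, False

/-- `DiluteSelfConsistency` with `∀ x, 0 < a₀ x` WEAKENED to `0 ≤ a₀ x`. -/
def DiluteSelfConsistencyNonnegActivity : Prop :=
  ∀ η : ℝ, 0 < η → ∀ (a₀ θ₀ : T3 → ℝ) (u₀ : T3 → V3), Continuous a₀ → Continuous θ₀ → Continuous u₀ →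
    (∀ x, 0 ≤ a₀ x) → (∀ x, 0 < θ₀ x) → ∃ σ₀ : ℝ, 0 < σ₀ ∧ ∀ σ : ℝ, 0 < σ → σ < σ₀ →
      ∀ (T : ℝ) (ρ θ : ℝ → T3 → ℝ) (u : ℝ → T3 → V3), IsHardSphereEulerSolution σ T ρ u θ →
        ∀ Φ : (N : ℕ) → HardSphereFlow (Torus.geometry (Fin 3)) (hsDiameter σ N) (N + 1),
          TendstoHydroFieldsAt (fun N => localGibbsLaw σ a₀ u₀ θ₀ N (Φ N)) Φ ρ u θ 0 →
            ∀ t ∈ Ico 0 T, ∀ x, ρ t x * σ ^ 3 < η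

/-- `DiluteSelfConsistency` with `∀ x, 0 < θ₀ x` WEAKENED to `0 ≤ θ₀ x`. -/
def DiluteSelfConsistencyNonnegTemperature : Prop :=
  ∀ η : ℝ, 0 < η → ∀ (a₀ θ₀ : T3 → ℝ) (u₀ : T3 → V3), Continuous a₀ → Continuous θ₀ → Continuous u₀ →
    (∀ x, 0 < a₀ x) → (∀ x, 0 ≤ θ₀ x) → ∃ σ₀ : ℝ, 0 < σ₀ ∧ ∀ σ : ℝ, 0 < σ → σ < σ₀ →
      ∀ (T : ℝ) (ρ θ : ℝ → T3 → ℝ) (u : ℝ → T3 → V3), IsHardSphereEulerSolution σ T ρ u θ →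
        ∀ Φ : (N : ℕ) → HardSphereFlow (Torus.geometry (Fin 3)) (hsDiameter σ N) (N + 1),
          TendstoHydroFieldsAt (fun N => localGibbsLaw σ a₀ u₀ θ₀ N (Φ N)) Φ ρ u θ 0 →
            ∀ t ∈ Ico 0 T, ∀ x, ρ t x * σ ^ 3 < η

/-- `DiluteSelfConsistency` with the `t = 0` ADMISSIBILITY TIE DELETED (every classical solution). -/
def DiluteSelfConsistencyUntied : Prop :=
  ∀ η : ℝ, 0 < η → ∀ (a₀ θ₀ : T3 → ℝ) (u₀ : T3 → V3), Continuous a₀ → Continuous θ₀ → Continuous u₀ →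
    (∀ x, 0 < a₀ x) → (∀ x, 0 < θ₀ x) → ∃ σ₀ : ℝ, 0 < σ₀ ∧ ∀ σ : ℝ, 0 < σ → σ < σ₀ →
      ∀ (T : ℝ) (ρ θ : ℝ → T3 → ℝ) (u : ℝ → T3 → V3), IsHardSphereEulerSolution σ T ρ u θ →
        ∀ t ∈ Ico 0 T, ∀ x, ρ t x * σ ^ 3 < η

/-- `DiluteSelfConsistency` UPGRADED TO A POLYNOMIAL RATE: packing `< σ^(3-κ)` for every `κ > 0`. -/
def DiluteSelfConsistencyPolynomialRate : Prop :=
  ∀ κ : ℝ, 0 < κ → ∀ (a₀ θ₀ : T3 → ℝ) (u₀ : T3 → V3), Continuous a₀ → Continuous θ₀ → Continuous u₀ →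
    (∀ x, 0 < a₀ x) → (∀ x, 0 < θ₀ x) → ∃ σ₀ : ℝ, 0 < σ₀ ∧ ∀ σ : ℝ, 0 < σ → σ < σ₀ →
      ∀ (T : ℝ) (ρ θ : ℝ → T3 → ℝ) (u : ℝ → T3 → V3), IsHardSphereEulerSolution σ T ρ u θ →
        ∀ Φ : (N : ℕ) → HardSphereFlow (Torus.geometry (Fin 3)) (hsDiameter σ N) (N + 1),
          TendstoHydroFieldsAt (fun N => localGibbsLaw σ a₀ u₀ θ₀ N (Φ N)) Φ ρ u θ 0 →
            ∀ t ∈ Ico 0 T, ∀ x, ρ t x * σ ^ 3 < σ ^ (3 - κ)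

/-- `DiluteSelfConsistency` UPGRADED TO A `σ`-UNIFORM DENSITY BOUND `ρ ≤ M(profiles)` (packing `≤ Mσ³`). -/
def DiluteSelfConsistencyBoundedDensity : Prop :=
  ∀ (a₀ θ₀ : T3 → ℝ) (u₀ : T3 → V3), Continuous a₀ → Continuous θ₀ → Continuous u₀ →
    (∀ x, 0 < a₀ x) → (∀ x, 0 < θ₀ x) → ∃ M : ℝ, ∃ σ₀ : ℝ, 0 < σ₀ ∧ ∀ σ : ℝ, 0 < σ → σ < σ₀ →
      ∀ (T : ℝ) (ρ θ : ℝ → T3 → ℝ) (u : ℝ → T3 → V3), IsHardSphereEulerSolution σ T ρ u θ →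
        ∀ Φ : (N : ℕ) → HardSphereFlow (Torus.geometry (Fin 3)) (hsDiameter σ N) (N + 1),
          TendstoHydroFieldsAt (fun N => localGibbsLaw σ a₀ u₀ θ₀ N (Φ N)) Φ ρ u θ 0 →
            ∀ t ∈ Ico 0 T, ∀ x, ρ t x ≤ M

/-! ## The admissible rest state of the homogeneous gas -/

namespace DiluteSelfConsistencyNegative

/-- The LLN density of the HOMOGENEOUS canonical hard-sphere gas is constant in space (the profile `β ≡ 1/∫1`
enters `rhoLim` only through its point values). [folklore] -/
theorem rhoLim_const_profile (hc : Continuous fun _ : T3 => (1 : ℝ)) (hp : ∀ _ : T3, (0 : ℝ) < 1) (σ : ℝ)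
    (x y : T3) : rhoLim (profileOf (fun _ => (1 : ℝ)) hc hp) σ x = rhoLim (profileOf (fun _ => (1 : ℝ)) hc hp) σ y := by
  unfold rhoLim
  simp only [profileOf_β]

/-- **THE HYPOTHESIS CLASS OF THE CRUX IS INHABITED AT EVERY SMALL `σ`.** For the homogeneous profiles
`(a₀, u₀, θ₀) = (1, 0, 1)` there is an absolute `σ₁ ∈ (0, 1/2]` such that for every `0 < σ < σ₁` the rest state of
density `r = rhoLim (profileOf 1) σ · > 0` (velocity `0`, temperature `1`) is a classical hard-sphere-Euler
solution on `[0, 1)` which is ADMISSIBLE: tied at `t = 0` to the local Gibbs laws through a flow family (flows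
exist by Alexander's theorem; LLN with identified density `lln_rhoLim`). [folklore] -/
theorem exists_admissible_restState :
    ∃ σ₁ : ℝ, 0 < σ₁ ∧ σ₁ ≤ 1 / 2 ∧ ∀ σ : ℝ, 0 < σ → σ < σ₁ → ∃ r : ℝ, 0 < r ∧
      IsHardSphereEulerSolution σ 1 (fun _ _ => r) (fun _ _ => (0 : V3)) (fun _ _ => (1 : ℝ)) ∧
      ∃ Φ : (N : ℕ) → HardSphereFlow (Torus.geometry (Fin 3)) (hsDiameter σ N) (N + 1),
        TendstoHydroFieldsAt (fun N => localGibbsLaw σ (fun _ => (1 : ℝ)) (fun _ => (0 : V3)) (fun _ => (1 : ℝ)) N (Φ N))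
          Φ (fun _ _ => r) (fun _ _ => (0 : V3)) (fun _ _ => (1 : ℝ)) 0 := by
  have hc : Continuous fun _ : T3 => (1 : ℝ) := continuous_const
  have hp : ∀ _ : T3, (0 : ℝ) < 1 := fun _ => one_pos
  obtain ⟨σ₁, hσ₁, hσ₁2, H⟩ := PolynomialCompressionPDE.lln_rhoLim (a₀ := fun _ => (1 : ℝ))
    (θ₀ := fun _ => (1 : ℝ)) (u₀ := fun _ => (0 : V3)) hc continuous_const continuous_const hp (fun _ => one_pos)
  refine ⟨σ₁, hσ₁, hσ₁2, fun σ hσ hσlt => ?_⟩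
  obtain ⟨hSD, hmargin, hΦ⟩ := H σ hσ hσlt
  set P := profileOf (fun _ => (1 : ℝ)) hc hp with hP
  set r : ℝ := rhoLim P σ 0 with hr
  have hrx : ∀ x, rhoLim P σ x = r := fun x => rhoLim_const_profile hc hp σ x 0
  have hr0 : 0 < r := hSD.rhoLim_pos (hmargin 0)
  obtain ⟨Φ⟩ := DenseExcursionDichotomy.flows_nonempty hσ (hσlt.trans_le hσ₁2)
  refine ⟨r, hr0, DenseExcursionUntied.isHardSphereEulerSolution_const σ 1 0 hr0 one_pos, Φ, ?_⟩
  have hT := (hΦ Φ).2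
  have e : (fun _ : ℝ => rhoLim P σ) = fun (_ : ℝ) (_ : T3) => r := funext fun _ => funext hrx
  rw [e] at hT
  exact hT

end DiluteSelfConsistencyNegative

open DiluteSelfConsistencyNegative

/-! ## The level `η`: positivity is load-bearing, and `σ₀` must depend on it -/

/-- NON-VACUITY: the crux is not true for want of admissible solutions — below every threshold there are
admissible classical solutions with positive existence time (the homogeneous rest states). [folklore] -/
theorem not_diluteSelfConsistencyVacuous : ¬ DiluteSelfConsistencyVacuous := by
  intro h
  obtain ⟨σ₁, hσ₁, -, H⟩ := exists_admissible_restState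
  obtain ⟨σ₀, hσ₀, D⟩ := h (fun _ => 1) (fun _ => 1) (fun _ => 0) continuous_const continuous_const
    continuous_const (fun _ => one_pos) (fun _ => one_pos)
  have hσ : 0 < min σ₀ σ₁ / 2 := by positivity
  obtain ⟨r, -, hE, Φ, hΦ⟩ := H _ hσ (by have := min_le_right σ₀ σ₁; linarith)
  exact D _ hσ (by have := min_le_left σ₀ σ₁; linarith) 1 _ _ _ hE Φ hΦ 0 ⟨le_rfl, one_pos⟩

/-- **`0 < η` IS LOAD-BEARING**: at level `η = 0` the crux fails, since the admissible rest state has packing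
`r σ³ > 0` at `t = 0`. So any proof must use the positivity of the level (trivially: the conclusion is a strict
bound on a positive quantity). [folklore] -/
theorem diluteSelfConsistency_false_without_level_pos : ¬ DiluteSelfConsistencyAnyLevel := by
  intro h
  obtain ⟨σ₁, hσ₁, -, H⟩ := exists_admissible_restState
  obtain ⟨σ₀, hσ₀, D⟩ := h 0 (fun _ => 1) (fun _ => 1) (fun _ => 0) continuous_const continuous_const
    continuous_const (fun _ => one_pos) (fun _ => one_pos)
  have hσ : 0 < min σ₀ σ₁ / 2 := by positivity
  obtain ⟨r, hr, hE, Φ, hΦ⟩ := H _ hσ (by have := min_le_right σ₀ σ₁; linarith)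
  have hlt := D _ hσ (by have := min_le_left σ₀ σ₁; linarith) 1 _ _ _ hE Φ hΦ 0 ⟨le_rfl, one_pos⟩ 0
  have hpos : 0 < r * (min σ₀ σ₁ / 2) ^ 3 := by positivity
  exact absurd hlt (not_lt.2 hpos.le)

/-- **`σ₀` MUST DEPEND ON THE LEVEL**: the `η`-uniform form `∃ σ₀ ∀ η > 0` fails (it says admissible packing is
`≤ 0` below `σ₀`; test it at `η :=` the packing `r σ³ > 0` of the rest state). The crux is exactly the statement
`limsup_{σ → 0} sup_{t,x} ρσ³ = 0` profile by profile, not "eventually zero". [folklore] -/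
theorem not_diluteSelfConsistencyLevelUniform : ¬ DiluteSelfConsistencyLevelUniform := by
  intro h
  obtain ⟨σ₁, hσ₁, -, H⟩ := exists_admissible_restState
  obtain ⟨σ₀, hσ₀, D⟩ := h (fun _ => 1) (fun _ => 1) (fun _ => 0) continuous_const continuous_const
    continuous_const (fun _ => one_pos) (fun _ => one_pos)
  have hσ : 0 < min σ₀ σ₁ / 2 := by positivity
  obtain ⟨r, hr, hE, Φ, hΦ⟩ := H _ hσ (by have := min_le_right σ₀ σ₁; linarith)
  have hpos : 0 < r * (min σ₀ σ₁ / 2) ^ 3 := by positivity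
  have hlt := D _ hpos _ hσ (by have := min_le_left σ₀ σ₁; linarith) 1 _ _ _ hE Φ hΦ 0 ⟨le_rfl, one_pos⟩ 0
  exact lt_irrefl _ hlt

/-! ## Positivity of the profiles and the tie (re-typed from the `DenseExcursion` load-bearing map) -/

/-- **`a₀ > 0` IS LOAD-BEARING**: with `a₀ ≡ 0` allowed the local Gibbs laws vanish, the tie is vacuous and the
dense rest state `(σ₀/2)⁻³` is admissible (`denseExcursionNonnegActivity_holds`). [folklore] -/
theorem diluteSelfConsistency_false_without_activity_pos : ¬ DiluteSelfConsistencyNonnegActivity := by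
  intro h
  obtain ⟨η, hη, a₀, θ₀, u₀, ha, hθ, hu, ha0, hθ0, H⟩ := denseExcursionNonnegActivity_holds
  obtain ⟨σ₀, hσ₀, D⟩ := h η hη a₀ θ₀ u₀ ha hθ hu ha0 hθ0
  obtain ⟨σ, hσ, hσlt, T, ρ, θ, u, hE, hA, t, ht, x, hx⟩ := H (min σ₀ (1 / 2)) (lt_min hσ₀ (by norm_num))
  obtain ⟨Φ⟩ := DenseExcursionDichotomy.flows_nonempty hσ (lt_of_lt_of_le hσlt (min_le_right _ _))
  exact absurd (D σ hσ (lt_of_lt_of_le hσlt (min_le_left _ _)) T ρ θ u hE Φ (hA Φ) t ht x) (not_lt.2 hx)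

/-- **`θ₀ > 0` IS LOAD-BEARING**: at `θ₀ ≡ 0` the local Maxwellian is the junk value `0`, the laws vanish and the
same dense rest state is admissible (`denseExcursionNonnegTemperature_holds`). [folklore] -/
theorem diluteSelfConsistency_false_without_temperature_pos : ¬ DiluteSelfConsistencyNonnegTemperature := by
  intro h
  obtain ⟨η, hη, a₀, θ₀, u₀, ha, hθ, hu, ha0, hθ0, H⟩ := denseExcursionNonnegTemperature_holds
  obtain ⟨σ₀, hσ₀, D⟩ := h η hη a₀ θ₀ u₀ ha hθ hu ha0 hθ0
  obtain ⟨σ, hσ, hσlt, T, ρ, θ, u, hE, hA, t, ht, x, hx⟩ := H (min σ₀ (1 / 2)) (lt_min hσ₀ (by norm_num))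
  obtain ⟨Φ⟩ := DenseExcursionDichotomy.flows_nonempty hσ (lt_of_lt_of_le hσlt (min_le_right _ _))
  exact absurd (D σ hσ (lt_of_lt_of_le hσlt (min_le_left _ _)) T ρ θ u hE Φ (hA Φ) t ht x) (not_lt.2 hx)

/-- **THE TIE IS LOAD-BEARING**: untied, the constant state of density `σ⁻³` (packing `1`) is a classical solution
at every `σ` (`denseExcursionUntied_holds`), so "every classical solution stays dilute" is false. [folklore] -/
theorem diluteSelfConsistency_false_untied : ¬ DiluteSelfConsistencyUntied := by
  intro h
  obtain ⟨η, hη, a₀, θ₀, u₀, ha, hθ, hu, ha0, hθ0, H⟩ := denseExcursionUntied_holds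
  obtain ⟨σ₀, hσ₀, D⟩ := h η hη a₀ θ₀ u₀ ha hθ hu ha0 hθ0
  obtain ⟨σ, hσ, hσlt, T, ρ, θ, u, hE, t, ht, x, hx⟩ := H σ₀ hσ₀
  exact absurd (D σ hσ hσlt T ρ θ u hE t ht x) (not_lt.2 hx)

/-! ## No quantitative upgrade: `PolynomialCompression` is proved -/

/-- **NO POLYNOMIAL RATE**: the crux cannot be upgraded to packing `< σ^(3-κ)` for any fixed `κ > 0` and all
profiles — along the PROVED `PolynomialCompression` family density `σ^(-κ)` (packing `σ^(3-κ)`) is reached.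
[folklore] -/
theorem not_diluteSelfConsistencyPolynomialRate : ¬ DiluteSelfConsistencyPolynomialRate := by
  intro h
  obtain ⟨κ, hκ, a₀, θ₀, u₀, ha, hθ, hu, ha0, hθ0, H⟩ := polynomialCompression_proof
  obtain ⟨σ₀, hσ₀, D⟩ := h κ hκ a₀ θ₀ u₀ ha hθ hu ha0 hθ0
  obtain ⟨σ, hσ, hσlt, T, ρ, θ, u, hE, hA, t, ht, x, hx⟩ := H (min σ₀ (1 / 2)) (lt_min hσ₀ (by norm_num))
  obtain ⟨Φ⟩ := DenseExcursionDichotomy.flows_nonempty hσ (lt_of_lt_of_le hσlt (min_le_right _ _))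
  have hlt := D σ hσ (lt_of_lt_of_le hσlt (min_le_left _ _)) T ρ θ u hE Φ (hA Φ) t ht x
  rw [PolynomialCompressionAt.rpow_three_sub σ κ hσ] at hlt
  have hσ3 : 0 < σ ^ (3 : ℕ) := pow_pos hσ 3
  have hle : σ ^ (3 : ℕ) * σ ^ (-κ) ≤ ρ t x * σ ^ 3 := by
    rw [mul_comm (ρ t x)]
    exact mul_le_mul_of_nonneg_left hx hσ3.le
  exact absurd hlt (not_lt.2 hle)

/-- **NO `σ`-UNIFORM DENSITY BOUND** along admissible solutions from fixed profiles (so in particular no bound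
"packing `≤ M(profiles) σ³`"): refuted by the proved `PolynomialCompression` at a `σ` with `σ^(-κ) > M`.
[folklore] -/
theorem not_diluteSelfConsistencyBoundedDensity : ¬ DiluteSelfConsistencyBoundedDensity := by
  intro h
  obtain ⟨κ, hκ, a₀, θ₀, u₀, ha, hθ, hu, ha0, hθ0, H⟩ := polynomialCompression_proof
  obtain ⟨M, σ₀, hσ₀, D⟩ := h a₀ θ₀ u₀ ha hθ hu ha0 hθ0
  -- a scale `ε ∈ (0, 1]` below which `σ^(-κ) > M`
  set A : ℝ := max M 1 with hA
  have hA1 : 1 ≤ A := le_max_right _ _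
  have hA0 : 0 < A := one_pos.trans_le hA1
  set ε : ℝ := A⁻¹ ^ (1 / κ) with hε
  have hε0 : 0 < ε := Real.rpow_pos_of_pos (inv_pos.2 hA0) _
  obtain ⟨σ, hσ, hσlt, T, ρ, θ, u, hE, hAd, t, ht, x, hx⟩ :=
    H (min σ₀ (min (1 / 2) ε)) (lt_min hσ₀ (lt_min (by norm_num) hε0))
  have hσ₀' : σ < σ₀ := lt_of_lt_of_le hσlt (min_le_left _ _)
  have hσ2 : σ < 1 / 2 := lt_of_lt_of_le hσlt ((min_le_right _ _).trans (min_le_left _ _))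
  have hσε : σ < ε := lt_of_lt_of_le hσlt ((min_le_right _ _).trans (min_le_right _ _))
  obtain ⟨Φ⟩ := DenseExcursionDichotomy.flows_nonempty hσ hσ2
  have hle := D σ hσ hσ₀' T ρ θ u hE Φ (hAd Φ) t ht x
  -- `σ^κ < ε^κ = A⁻¹`, hence `σ^(-κ) > A ≥ M`
  have hσκ : σ ^ κ < A⁻¹ := by
    have h1 : σ ^ κ < ε ^ κ := Real.rpow_lt_rpow hσ.le hσε hκ
    have h2 : ε ^ κ = A⁻¹ := by
      rw [hε, ← Real.rpow_mul (inv_pos.2 hA0).le, one_div_mul_cancel hκ.ne', Real.rpow_one]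
    rwa [h2] at h1
  have hσκ0 : 0 < σ ^ κ := Real.rpow_pos_of_pos hσ _
  have hgt : A < σ ^ (-κ) := by
    rw [Real.rpow_neg hσ.le, lt_inv_comm₀ hA0 hσκ0]
    exact hσκ
  have hM : M < ρ t x := (le_max_left M 1).trans_lt (hgt.trans_le hx)
  exact absurd hle (not_le.2 hM)

end Summit.AtomisticToContinuum.HydrodynamicLimit.Theorems

end
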